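import Summits.BirchSwinnertonDyer.BirchSwinnertonDyer.Theorems.EisensteinPrimesAcTwistDeformationImprimCorank
import Summits.BirchSwinnertonDyer.BirchSwinnertonDyer.Theorems.EisensteinPrimesGoodLatticeImprimitiveOfQuotient
import Summits.BirchSwinnertonDyer.BirchSwinnertonDyer.Theorems.EisensteinPrimesGoodLatticeQuotientOfCorank
import Summits.BirchSwinnertonDyer.BirchSwinnertonDyer.Theorems.EisensteinPrimesSplitMultLambdaLEOffP
import HarnessLib

/-!
# Crux 4 `BSDpOnCellC` (stmt-BirchSwinnertonDyer-19034), line b1 — the SPLIT conjunct of the wall `stub_imprimitiveCount`: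
# THE IMPRIMITIVE → PRIMITIVE `λ`-SHIFT FOR THE TWO RESIDUAL CHARACTERS AT A SPLIT MULTIPLICATIVE EISENSTEIN PRIME —
# `λ(𝔛^{Sf}_nr(θ)) = λ(𝔛_nr(θ)) + Σ_{w∈Sf} λ𝒫_w(θ)` for `θ ∈ {θsub, θquot}`, `Sf` = places over `N` off `p` (Keller–Yin Prop. 1.2.5
# (eq:Gr to imp) / CGLS Prop. 1.2.5, in the kernel modulo Greenberg's five facts BY NAME) — the x1 cell's road (A) run off `Good`/`Anom`

Cell `bsd-eis` (run/shared/lean/pub/bsd-eis/), width seat `bsd-line-x2-p2` gen 10 (`--supports -19034`, closes nothing; skeleton of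
record b1 v12 sha256 155e218d… UNCHANGED, W-79). Sequel of this seat's split files (p672062 … p675389).

WHY. After `SplitMultSfTransfer.lambdaInvariant_add_le_of_split_offP` (this seat) the algebraic side of conj. 2 reads
`λ(DSsub.X) + λ(DSquot.X) ≤ λ(𝔛^{Sf}_f) + [θquot = 𝟙]` for the IMPRIMITIVE unramified duals over line b1's `Sf`; the character main
conjectures ([BR𝟙] `X1.KellerYinMuLambdaSplit.CharMainConjOnTree`, the (2.16)-reading at `θsub`) speak about the PRIMITIVE duals (`S = ∅`).
The bridge is Keller–Yin Prop. 1.2.5 (eq:Gr to imp): `λ(𝔛^{Sf}_θ) = λ(𝔛_θ) + Σ_{w∈Sf} λ(𝒫_w(θ))`. The x1 cell proved it for the residual pair of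
the GOOD anomalous lattice (named fact `KellerYin2024.prop125_residualPair_unrSelmer_imprimitive`, kernel modulo PUB: LEAD x1-p1 g2's road (A)
`AcTwistDeformation.prop125_residualPair_unrSelmer_corank_ge_of_facts` — twist deformation `𝐃₁(θ)`, Greenberg's SUR, Shapiro descent —, `≤` by
`UnrSelmerQuotientCorankLocalLambda`, finiteness `UnrSelmerQuotientTorsionFiniteChar`, `λ`-shift `UnrSelmerImprimitiveFiniteness`). Road (A)
used `Good W p` at ONE point only — to know that no place of `Sf` lies over `p` —, and otherwise the convention `w ∈ Sf ↔ N ∈ w`; at a SPLIT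
multiplicative prime line b1's `Sf` (places over `N` OFF `p`) is the set of places over the prime-to-`p` part `N' = N / p^{v_p(N)}` of the
conductor, which still satisfies (Heeg), so every `N`-generic producer applies VERBATIM with `N'`, and the one `W`-specific producer
(`ramificationSubgroup_le_ker_unitChar_of_residualPair`: `θ` unramified outside `Sf ∪ {v, v̄}`) with `Sf ∪ {v, v̄}`. THIS FILE:

* §0 bookkeeping: `intCast_ordCompl_mem_iff` (`N' ∈ w ↔ N ∈ w ∧ p ∉ w`), `mem_insert_insert_iff_conductorNorm_mem` (`Sf ∪ {v, v̄}` = the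
  places over `N` at a split multiplicative `p`);
* §1 `sum_charLocalLambda_le_zpCorank_unrSelmer_quotient_of_split` — road (A)'s `≥` at the split datum: GRANTED Greenberg 2016 Prop. 2.6.3,
  Greenberg 2006 Props. 4.1, 4.2, §5 A, 3.2 BY NAME and [RH] for `θ` (`∀ D` primitive dual datum f.g. torsion `μ = 0`),
  `Σ_{w∈Sf} λ𝒫_w(θ) ≤ corank_{ℤ_p}(H¹_{𝓕_nr^{Sf}}/H¹_{𝓕_nr})` for `θ ∈ {θsub, θquot}`;
* §2 `imprimitive_clauses_of_split` — the whole Prop. 1.2.5 package at the split datum: every imprimitive dual datum `DS` over `Sf` is f.g.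
  `Λ`-torsion with `μ = 0` AND `λ(DS.X) = λ(D.X) + Σ_{w∈Sf} λ𝒫_w(θ)` for every primitive `D`.

HONEST FRAMING: helper theorems only (0 defs, 0 named facts introduced, 0 sorry); CONDITIONAL on the five named Greenberg facts (hypotheses,
already inputs of both cells' chains); closes no stub; no summit statement / BSD / MC / IMC is proved for any curve; 0 cells / labels / tiers move.

References: [KellerYin2024] Prop. 1.2.5 (eq:Gr to imp), Lemma 1.1.1, Rem. 1.2.3 (ii), §5.1 (arXiv:2402.12781v2 TeX L780–800, L455–462, L690–712,
L1725–1769); [CastellaGrossiLeeSkinner2022] Prop. 1.2.5 and proof ((eq:sur1)–(eq:sur2)); [Greenberg2016Selmer] Prop. 2.6.3; [Greenberg2006] Props.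
3.2, 4.1, 4.2, §5 A; [PollackWeston2011] App. A Prop. A.2; [GreenbergVatsal2000] §2 Cor. (2.3), Prop. (2.4); [Brink2007] Thm. 2.
-/

set_option autoImplicit false
set_option linter.dupNamespace false

noncomputable section

open scoped Classical
open NumberField IsDedekindDomain Field Multiplicative PowerSeries WeierstrassCurve
open Literature.NumberTheory.EllipticCurves Literature.NumberTheory.EllipticCurves.GreenbergSelmer
  Literature.NumberTheory.EllipticCurves.GreenbergVatsal2000 Literature.NumberTheory.GaloisRepresentations
  Literature.NumberTheory.EllipticCurves.KellerYin2024 Literature.NumberTheory.EllipticCurves.IwasawaDual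
  Literature.NumberTheory.IwasawaTheory Literature.NumberTheory.IwasawaTheory.Greenberg2016
  Literature.NumberTheory.IwasawaTheory.Greenberg2006 Literature.NumberTheory.EllipticCurves.Castella2018
  Summit.BirchSwinnertonDyer.BirchSwinnertonDyer.Theorems
  Summit.BirchSwinnertonDyer.BirchSwinnertonDyer.Theorems.GreenbergFullAtSelmer
  Summit.BirchSwinnertonDyer.BirchSwinnertonDyer.Theorems.AcTwistDeformationResidualPair
  Summit.BirchSwinnertonDyer.BirchSwinnertonDyer.Theorems.UnrSelmerQuotientTorsionFiniteChar
  Summit.BirchSwinnertonDyer.BirchSwinnertonDyer.Theorems.AcTwistDeformation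

namespace Summit.BirchSwinnertonDyer.BirchSwinnertonDyer.Theorems.SplitMultCharImprimitiveShift

/-! ## §0. The prime-to-`p` part of the conductor and the two imprimitivity conventions -/

section Bookkeeping

variable {K : Type} [Field K] [NumberField K] {p : ℕ} [hp : Fact p.Prime]

/-- **The places over `N' = N / p^{v_p(N)}` are the places over `N` not over `p`** (`N ≠ 0`; `w` a prime of `𝓞 K`): `N = p^{v_p(N)} · N'` with
`p ∤ N'` (Bézout excludes `p, N' ∈ w` simultaneously). [folklore] -/
theorem intCast_ordCompl_mem_iff {N : ℕ} (hN : N ≠ 0) (w : HeightOneSpectrum (𝓞 K)) :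
    (((N / p ^ N.factorization p : ℕ) : ℤ) : 𝓞 K) ∈ w.asIdeal ↔
      ((N : ℤ) : 𝓞 K) ∈ w.asIdeal ∧ ((p : ℕ) : 𝓞 K) ∉ w.asIdeal := by
  have hpr : p.Prime := hp.out
  have hcop : Nat.Coprime p (N / p ^ N.factorization p) := Nat.coprime_ordCompl hpr hN
  have hndvd : ¬ p ∣ N / p ^ N.factorization p := fun hd ↦
    hpr.one_lt.ne' ((Nat.coprime_iff_gcd_eq_one.mp hcop) ▸ (Nat.gcd_eq_left hd)).symm
  have hmul : p ^ N.factorization p * (N / p ^ N.factorization p) = N := Nat.ordProj_mul_ordCompl_eq_self N p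
  constructor
  · intro h
    refine ⟨?_, GoodLatticeCorankOfGe.natCast_notMem_of_intCast_mem hndvd hpr w h⟩
    rw [Int.cast_natCast] at h ⊢
    rw [← hmul, Nat.cast_mul]
    exact w.asIdeal.mul_mem_left _ h
  · rintro ⟨hNw, hpw⟩
    rw [Int.cast_natCast] at hNw ⊢
    rw [← hmul, Nat.cast_mul] at hNw
    rcases w.isPrime.mem_or_mem hNw with h | h
    · rw [Nat.cast_pow] at h
      exact absurd (w.isPrime.mem_of_pow_mem _ h) hpw
    · exact h

/-- **At a split multiplicative `p`, `Sf ∪ {v, v̄}` is the set of places over `N_W`** when `Sf` is line b1's imprimitivity set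
(`w ∈ Sf ↔ (N_W ∈ w ∧ p ∉ w)`) and `v ≠ v̄` are the two places over `p` (`K` imaginary quadratic): the x1 producers' convention.
[cite: KellerYin2024, §5.1 (arXiv:2402.12781v2 TeX L1725–1735)] -/
theorem mem_insert_insert_iff_conductorNorm_mem (W : WeierstrassCurve ℚ) [W.IsElliptic] [W.IsGloballyMinimal]
    (hsplitred : W.HasSplitMultiplicativeReductionAtPrime p) (hK : IsImaginaryQuadratic K) {v vbar : HeightOneSpectrum (𝓞 K)}
    (hpv : ((p : ℕ) : 𝓞 K) ∈ v.asIdeal) (hvbar : ((p : ℕ) : 𝓞 K) ∈ vbar.asIdeal) (hne : vbar ≠ v)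
    (Sf : Finset (HeightOneSpectrum (𝓞 K)))
    (hSf : ∀ w : HeightOneSpectrum (𝓞 K), w ∈ Sf ↔
      (((W.conductorNorm ℤ : ℤ) : 𝓞 K) ∈ w.asIdeal ∧ ((p : ℕ) : 𝓞 K) ∉ w.asIdeal))
    (w : HeightOneSpectrum (𝓞 K)) :
    w ∈ insert v (insert vbar Sf) ↔ ((W.conductorNorm ℤ : ℤ) : 𝓞 K) ∈ w.asIdeal := by
  constructor
  · intro hw
    rw [Finset.mem_insert, Finset.mem_insert] at hw
    rcases hw with rfl | rfl | hw
    · exact SplitMultSfTransfer.conductorNorm_mem_of_natCast_mem W hsplitred hpv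
    · exact SplitMultSfTransfer.conductorNorm_mem_of_natCast_mem W hsplitred hvbar
    · exact ((hSf w).mp hw).1
  · intro hN
    by_cases hpw : ((p : ℕ) : 𝓞 K) ∈ w.asIdeal
    · have h := mem_insert_insert_of_natCast_mem hK hpv hvbar hne Sf w hpw
      rw [Finset.mem_coe] at h
      exact h
    · rw [Finset.mem_insert, Finset.mem_insert]
      exact Or.inr (Or.inr ((hSf w).mpr ⟨hN, hpw⟩))

end Bookkeeping

/-! ## §1. Road (A) at the SPLIT datum: `Σ_{w∈Sf} λ𝒫_w(θ) ≤ corank_{ℤ_p}(H¹_{𝓕_nr^{Sf}}/H¹_{𝓕_nr})` for `θ ∈ {θsub, θquot}` -/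

section RoadA

variable {K : Type} [Field K] [NumberField K] {p : ℕ} [hp : Fact p.Prime]

/-- **Keller–Yin Prop. 1.2.5 (eq:Gr to imp), `≥` direction, AT A SPLIT MULTIPLICATIVE EISENSTEIN PRIME, from the five Greenberg facts
BY NAME.** `W/ℚ` globally minimal, `2 < p` SPLIT multiplicative, `K` imaginary quadratic with (Heeg) for `N_W`, `v` through `ι`, `v̄ ∋ p`,
`v̄ ≠ v`, `κ` anticyclotomic with topological generator `γ`, `(θsub, θquot)` a residual pair of `E_K[p]`, `θ ∈ {θsub, θquot}`, `Sf` line b1's set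
(`w ∈ Sf ↔ (N_W ∈ w ∧ p ∉ w)`), and [RH] for `θ` (every PRIMITIVE dual datum of `H¹_{𝓕_nr}(K_∞, (F/𝒪)(θ))` f.g. `Λ`-torsion with `μ = 0`):
`Σ_{w∈Sf} charLocalLambda ∅ κ θ w ≤ corank_{ℤ_p}(H¹_{𝓕_nr^{Sf}}/H¹_{𝓕_nr})`. LEAD x1-p1 g2's road (A)
(`AcTwistDeformation.prop125_residualPair_unrSelmer_corank_ge_of_facts`) VERBATIM with the `N`-generic producers fed the prime-to-`p` part
`N' = N / p^{v_p(N)}` (still (Heeg)) and `θ`'s unramifiedness outside `S = Sf ∪ {v, v̄}` read from the places over `N` (§0).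
[cite: KellerYin2024, Prop. 1.2.5 (eq:Gr to imp), Rem. 1.2.3 (ii), §5.1 (arXiv:2402.12781v2 TeX L780–800, L690–712, L1725–1769)]
[cite: Greenberg2016Selmer, Prop. 2.6.3 (§2.6 p. 10)] [cite: Greenberg2006, Props. 3.2, 4.1, 4.2, §5 A] [cite: PollackWeston2011, App. A Prop. A.2] -/
theorem sum_charLocalLambda_le_zpCorank_unrSelmer_quotient_of_split (h263 : prop263_sur_of_crk)
    (h41 : prop41_globalEulerPoincareCorank) (h42 : prop42_localEulerPoincareCorank)
    (h5A : sec5A_localH2_subsingleton_of_LOC1) (h32 : prop32_cohomology_isCofinitelyGenerated)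
    (W : WeierstrassCurve ℚ) [W.IsElliptic] [W.IsGloballyMinimal] (hp : 2 < p)
    (hsplitred : W.HasSplitMultiplicativeReductionAtPrime p) (hK : IsImaginaryQuadratic K)
    (hH : SatisfiesHeegnerHypothesis (W.conductorNorm ℤ) K)
    {ι : K →+* ℚ_[p]} {v vbar : HeightOneSpectrum (𝓞 K)} (hvι : ∀ x : 𝓞 K, x ∈ v.asIdeal ↔ ‖ι (x : K)‖ < 1)
    (hvbar : ((p : ℕ) : 𝓞 K) ∈ vbar.asIdeal) (hne : vbar ≠ v)
    (κ : ZpExtension K p) (hκ : κ.IsAnticyclotomic) (γ : absoluteGaloisGroup K) [Fact (κ.IsTopGenerator γ)]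
    {θsub θquot : FramedGaloisRep K (padicCoeffIntegers (∅ : Set (PadicAlgCl p))) 1}
    (hpair : IsResidualPairOver (W.baseChange K) p θsub θquot)
    (Sf : Finset (HeightOneSpectrum (𝓞 K)))
    (hSf : ∀ w : HeightOneSpectrum (𝓞 K), w ∈ Sf ↔
      (((W.conductorNorm ℤ : ℤ) : 𝓞 K) ∈ w.asIdeal ∧ ((p : ℕ) : 𝓞 K) ∉ w.asIdeal))
    (θ : FramedGaloisRep K (padicCoeffIntegers (∅ : Set (PadicAlgCl p))) 1) (hθ : θ = θsub ∨ θ = θquot)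
    (hRH : ∀ D : DatumDualData κ γ (charModule ∅ θ)
        (AcSelmer.bdpData (charModule ∅ θ) p vbar) (∅ : Set (HeightOneSpectrum (𝓞 K))),
      Module.Finite (IwasawaAlgebra p) D.X ∧ Module.IsTorsion (IwasawaAlgebra p) D.X ∧ muInvariant p D.X = 0) :
    ∑ w ∈ Sf, charLocalLambda ∅ κ θ w ≤
      zpCorank (↥(unrSelmer κ (charModule ∅ θ) vbar (↑Sf : Set (HeightOneSpectrum (𝓞 K)))) ⧸
        (unrSelmer κ (charModule ∅ θ) vbar (∅ : Set (HeightOneSpectrum (𝓞 K)))).addSubgroupOf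
          (unrSelmer κ (charModule ∅ θ) vbar (↑Sf : Set (HeightOneSpectrum (𝓞 K))))) p := by
  have hγ : κ.IsTopGenerator γ := Fact.out
  have hv : ((p : ℕ) : 𝓞 K) ∈ v.asIdeal := IwasawaTwoVariable.natCast_mem_asIdeal_of_norm_iff hvι
  -- the prime-to-`p` part of the conductor: line b1's `Sf` is the set of places over it
  have hN0 : W.conductorNorm ℤ ≠ 0 := (W.conductorNorm_pos_holds).ne'
  set N' : ℕ := W.conductorNorm ℤ / p ^ (W.conductorNorm ℤ).factorization p with hN'def
  have hH' : SatisfiesHeegnerHypothesis N' K := hH.of_dvd (Nat.ordCompl_dvd (W.conductorNorm ℤ) p)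
  have hSf' : ∀ w : HeightOneSpectrum (𝓞 K), w ∈ Sf ↔ ((N' : ℤ) : 𝓞 K) ∈ w.asIdeal := fun w ↦ by
    rw [hSf, hN'def, intCast_ordCompl_mem_iff hN0]
  have hSfp : ∀ w ∈ Sf, ((p : ℕ) : 𝓞 K) ∉ w.asIdeal := fun w hw ↦ ((hSf w).mp hw).2
  have hSp : ∀ w : HeightOneSpectrum (𝓞 K), ((p : ℕ) : 𝓞 K) ∈ w.asIdeal → w = v ∨ w = vbar :=
    fun w hw ↦ eq_or_eq_of_natCast_mem_of_ne hK.1 hv hvbar hne hw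
  have hθpow : ∀ σ : absoluteGaloisGroup K, θ σ ^ (p - 1) = 1 := fun σ ↦ by
    rcases hθ with rfl | rfl
    · exact (hpair.pow_sub_one σ).1
    · exact (hpair.pow_sub_one σ).2
  -- every `w ∈ Sf` is finitely decomposed in `K_∞^{ac}` (Brink), with `κ(D_w) = p^{a_w} ℤ_p` exactly
  have hdec : ∀ w ∈ Sf, ¬ decomp (K := K) w ≤ κ.kerSubgroup := fun w hw hle ↦ by
    obtain ⟨δ, hδ, hne1⟩ := exists_mem_decomp_apply_ne_one_of_heegner hK hp hH' κ hκ w ((hSf' w).mp hw)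
      (hSfp w hw)
    exact hne1 (ZpExtension.mem_kerSubgroup.mp (hle hδ))
  have hexp : ∀ w : HeightOneSpectrum (𝓞 K), ∃ a : ℕ, w ∈ Sf →
      (∃ δ ∈ decomp (K := K) w, (κ δ).toAdd = (p : ℤ_[p]) ^ a) ∧
        ∀ δ ∈ decomp (K := K) w, (p : ℤ_[p]) ^ a ∣ (κ δ).toAdd := by
    intro w
    by_cases hw : w ∈ Sf
    · obtain ⟨c, ⟨d₀, hd₀⟩, -, hdvd⟩ :=
        UniversalToricDescentSigmaLocalStabilizer.exists_pow_and_forall_dvd_of_not_le κ w (hdec w hw)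
      exact ⟨c, fun _ ↦ ⟨⟨d₀, d₀.2, hd₀⟩, fun δ hδ ↦ hdvd ⟨δ, hδ⟩⟩⟩
    · exact ⟨0, fun h ↦ (hw h).elim⟩
  choose a ha using hexp
  have hd₀ : ∀ w ∈ Sf, ∃ δ ∈ decomp (K := K) w, (κ δ).toAdd = (p : ℤ_[p]) ^ a w :=
    fun w hw ↦ (ha w hw).1
  have hdiv : ∀ w ∈ Sf, ∀ δ ∈ decomp (K := K) w, (p : ℤ_[p]) ^ a w ∣ (κ δ).toAdd :=
    fun w hw ↦ (ha w hw).2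
  -- the representatives `γ^i` of the places above `w`: `κ(γ^i) = i`
  have hσrep : ∀ w ∈ Sf, ∀ i : ℕ, i < p ^ a w → (κ ((fun (_ : HeightOneSpectrum (𝓞 K)) (i : ℕ) ↦ γ ^ i) w i)).toAdd =
      (i : ℤ_[p]) := fun w _ i _ ↦ by
    change (κ (γ ^ i)).toAdd = (i : ℤ_[p])
    rw [map_pow, show κ γ = Multiplicative.ofAdd 1 from hγ, ← ofAdd_nsmul, toAdd_ofAdd, nsmul_one]
  -- `S = {v, v̄} ∪ Sf` = the places over `N_W`; `θ` is unramified outside `S`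
  have hS : ∀ w : HeightOneSpectrum (𝓞 K), ((p : ℕ) : 𝓞 K) ∈ w.asIdeal →
      w ∈ (↑(insert v (insert vbar Sf)) : Set (HeightOneSpectrum (𝓞 K))) :=
    mem_insert_insert_of_natCast_mem hK hv hvbar hne Sf
  have hSfS : ∀ w ∈ Sf, w ∈ (↑(insert v (insert vbar Sf)) : Set (HeightOneSpectrum (𝓞 K))) :=
    fun w hw ↦ by
    rw [Finset.coe_insert, Finset.coe_insert]
    exact Or.inr (Or.inr (Finset.mem_coe.mpr hw))
  have hSN : ∀ w : HeightOneSpectrum (𝓞 K), w ∈ insert v (insert vbar Sf) ↔ ((W.conductorNorm ℤ : ℤ) : 𝓞 K) ∈ w.asIdeal :=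
    mem_insert_insert_iff_conductorNorm_mem W hsplitred hK hv hvbar hne Sf hSf
  have h : ramificationSubgroup K (↑(insert v (insert vbar Sf)) : Set (HeightOneSpectrum (𝓞 K))) ≤
      (unitChar θ).toMonoidHom.ker :=
    ramificationSubgroup_le_ker_unitChar_of_residualPair W hpair (insert v (insert vbar Sf)) hSN _ (fun _ hw ↦ hw) hS θ hθ
  -- the canonical (discrete) topological instances of the model
  letI tΛ : TopologicalSpace (PowerSeries ℤ_[p]) := ⊥
  haveI : DiscreteTopology (PowerSeries ℤ_[p]) := ⟨rfl⟩
  haveI : IsTopologicalRing (PowerSeries ℤ_[p]) := inferInstance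
  haveI hAdisc : DiscreteTopology (QpModZp p) := QpModZp.discreteTopology p
  haveI : IsTopologicalAddGroup (BigRepModule ℤ_[p] p (QpModZp p)) := inferInstance
  haveI : ContinuousSMul (PowerSeries ℤ_[p]) (BigRepModule ℤ_[p] p (QpModZp p)) := inferInstance
  -- the model `ρ_θ` on `ℚ_p/ℤ_p`, `ψ = (charModuleEquiv θ)⁻¹`, the Shapiro descent `F`, and [RH]
  have hψ := charModuleEquiv_symm_galois (↑(insert v (insert vbar Sf)) : Set (HeightOneSpectrum (𝓞 K))) θ h
  obtain ⟨F, hF⟩ := exists_shapiroDescent _ hS κ (characterRepUnramified _ θ h) (charModuleEquiv θ).symm hψ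
  obtain ⟨hSel, hSelfg⟩ := hasCorank_fullAtSelmer_zero_of_RH hK κ hγ hv hvbar hne θ _ hS h hRH
  -- the `K_∞`-side global-to-local surjectivity at the places of `Sf` (all off `p`)
  have h8 : ∀ y : ∀ w : HeightOneSpectrum (𝓞 K), ℕ →
      subgroupH1 (κ.kerSubgroup ⊓ decomp (K := K) w) (charModule (∅ : Set (PadicAlgCl p)) θ),
      ∃ u ∈ unrSelmer κ (charModule (∅ : Set (PadicAlgCl p)) θ) vbar (↑Sf : Set (HeightOneSpectrum (𝓞 K))),
        ∀ w ∈ Sf, ∀ i : ℕ, i < p ^ a w →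
          resOfLe (charModule (∅ : Set (PadicAlgCl p)) θ)
            (inf_le_left : κ.kerSubgroup ⊓ decomp (K := K) w ≤ κ.kerSubgroup)
            (conjH1 κ.kerSubgroup (charModule (∅ : Set (PadicAlgCl p)) θ) (γ ^ i) u) = y w i := fun y ↦
    exists_mem_unrSelmer_forall_resOfLe_conjH1_eq _ hS κ (characterRepUnramified _ θ h)
      (charModuleEquiv θ).symm hψ h263 h41 h42 h5A h32 (Finset.finite_toSet _) hK
      (LinearEquiv.refl ℤ_[p] (QpModZp p)) (characterRepUnramified_hscalar _ θ h)
      (fun w hw ↦ exists_local_apply_ne_one_of_mem_insert_insert hK hp hH κ hκ hv hvbar (insert v (insert vbar Sf)) hSN w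
        (by rw [Finset.coe_insert, Finset.coe_insert]; exact Or.inr (Or.inr hw)))
      hne hv hvbar hSp hSel hSelfg (fun b ↦ QpModZp.exists_pow_nsmul_eq_zero b) hF Sf hSfS hSfp a hdiv hd₀
      (fun _ i ↦ γ ^ i) hσrep y
  -- corank bookkeeping (x1-p1-w2's adapter, generic core)
  exact UnrSelmerLocSurjAdapter.sum_charLocalLambda_le_zpCorank_unrSelmer_quotient_of_forall_exists κ θ vbar Sf hθpow hγ hSfp
    (fun w hw ↦ exists_mem_decomp_apply_ne_one_of_heegner hK hp hH' κ hκ w ((hSf' w).mp hw) (hSfp w hw)) a hdiv hd₀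
    (fun _ i ↦ γ ^ i) hσrep h8

end RoadA

/-! ## §2. The Prop. 1.2.5 package at the split datum: cotorsion and the `λ`-shift of every imprimitive dual datum -/

section Package

variable {K : Type} [Field K] [NumberField K] {p : ℕ} [hp : Fact p.Prime]

/-- **Keller–Yin / CGLS Prop. 1.2.5 for the residual characters AT A SPLIT MULTIPLICATIVE EISENSTEIN PRIME, in the kernel modulo Greenberg's five
facts BY NAME.** Same binders as `sum_charLocalLambda_le_zpCorank_unrSelmer_quotient_of_split`; conclusion: for EVERY imprimitive unramified dual
datum `DS` over line b1's `Sf` and every primitive one `D`: `DS.X` is f.g. `Λ`-torsion with `μ = 0` and `λ(DS.X) = λ(D.X) + Σ_{w∈Sf} λ𝒫_w(θ)`.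
Assembly: §1 (`≥`) + `UnrSelmerQuotientCorankLocalLambda.zpCorank_unrSelmer_quotient_le_at_residualPair` (`≤`, at `N'`) + the finiteness of
`(H¹_{𝓕_nr^{Sf}}/H¹_{𝓕_nr})[p]` (`UnrSelmerQuotientTorsionFiniteChar.finite_torsionBy_unrSelmer_quotient`, at `N'`) + Greenberg–Vatsal Cor. (2.3)
for the character module (`UnrSelmerImprimitiveFiniteness.moduleFinite_isTorsion_mu_lambda_of_primitive`).
[cite: KellerYin2024, Prop. 1.2.5 and proof (arXiv:2402.12781v2 TeX L780–800)] [cite: CastellaGrossiLeeSkinner2022, Prop. 1.2.5 and proof]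
[cite: GreenbergVatsal2000, §2 Cor. (2.3) (pp. 20–21)] [cite: Greenberg2016Selmer, Prop. 2.6.3] [cite: Greenberg2006, Props. 3.2, 4.1, 4.2, §5 A] -/
theorem imprimitive_clauses_of_split (h263 : prop263_sur_of_crk)
    (h41 : prop41_globalEulerPoincareCorank) (h42 : prop42_localEulerPoincareCorank)
    (h5A : sec5A_localH2_subsingleton_of_LOC1) (h32 : prop32_cohomology_isCofinitelyGenerated)
    (W : WeierstrassCurve ℚ) [W.IsElliptic] [W.IsGloballyMinimal] (hp : 2 < p)
    (hsplitred : W.HasSplitMultiplicativeReductionAtPrime p) (hK : IsImaginaryQuadratic K)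
    (hH : SatisfiesHeegnerHypothesis (W.conductorNorm ℤ) K)
    {ι : K →+* ℚ_[p]} {v vbar : HeightOneSpectrum (𝓞 K)} (hvι : ∀ x : 𝓞 K, x ∈ v.asIdeal ↔ ‖ι (x : K)‖ < 1)
    (hvbar : ((p : ℕ) : 𝓞 K) ∈ vbar.asIdeal) (hne : vbar ≠ v)
    (κ : ZpExtension K p) (hκ : κ.IsAnticyclotomic) (γ : absoluteGaloisGroup K) [Fact (κ.IsTopGenerator γ)]
    {θsub θquot : FramedGaloisRep K (padicCoeffIntegers (∅ : Set (PadicAlgCl p))) 1}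
    (hpair : IsResidualPairOver (W.baseChange K) p θsub θquot)
    (Sf : Finset (HeightOneSpectrum (𝓞 K)))
    (hSf : ∀ w : HeightOneSpectrum (𝓞 K), w ∈ Sf ↔
      (((W.conductorNorm ℤ : ℤ) : 𝓞 K) ∈ w.asIdeal ∧ ((p : ℕ) : 𝓞 K) ∉ w.asIdeal))
    (θ : FramedGaloisRep K (padicCoeffIntegers (∅ : Set (PadicAlgCl p))) 1) (hθ : θ = θsub ∨ θ = θquot)
    (hRH : ∀ D : DatumDualData κ γ (charModule ∅ θ)
        (AcSelmer.bdpData (charModule ∅ θ) p vbar) (∅ : Set (HeightOneSpectrum (𝓞 K))),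
      Module.Finite (IwasawaAlgebra p) D.X ∧ Module.IsTorsion (IwasawaAlgebra p) D.X ∧ muInvariant p D.X = 0)
    (D : DatumDualData κ γ (charModule ∅ θ) (AcSelmer.bdpData (charModule ∅ θ) p vbar) (∅ : Set (HeightOneSpectrum (𝓞 K))))
    (DS : DatumDualData κ γ (charModule ∅ θ) (AcSelmer.bdpData (charModule ∅ θ) p vbar) (↑Sf : Set (HeightOneSpectrum (𝓞 K)))) :
    Module.Finite (IwasawaAlgebra p) DS.X ∧ Module.IsTorsion (IwasawaAlgebra p) DS.X ∧ muInvariant p DS.X = 0 ∧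
      lambdaInvariant p DS.X = lambdaInvariant p D.X + ∑ w ∈ Sf, charLocalLambda ∅ κ θ w := by
  have hγ : κ.IsTopGenerator γ := Fact.out
  have hN0 : W.conductorNorm ℤ ≠ 0 := (W.conductorNorm_pos_holds).ne'
  set N' : ℕ := W.conductorNorm ℤ / p ^ (W.conductorNorm ℤ).factorization p with hN'def
  have hH' : SatisfiesHeegnerHypothesis N' K := hH.of_dvd (Nat.ordCompl_dvd (W.conductorNorm ℤ) p)
  have hSf' : ∀ w : HeightOneSpectrum (𝓞 K), w ∈ Sf ↔ ((N' : ℤ) : 𝓞 K) ∈ w.asIdeal := fun w ↦ by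
    rw [hSf, hN'def, intCast_ordCompl_mem_iff hN0]
  have hSfp : ∀ w ∈ Sf, ((p : ℕ) : 𝓞 K) ∉ w.asIdeal := fun w hw ↦ ((hSf w).mp hw).2
  -- the corank IDENTITY of the quotient
  have hge := sum_charLocalLambda_le_zpCorank_unrSelmer_quotient_of_split h263 h41 h42 h5A h32 W hp hsplitred hK hH hvι hvbar hne κ hκ
    γ hpair Sf hSf θ hθ hRH
  have hle := UnrSelmerQuotientCorankLocalLambda.zpCorank_unrSelmer_quotient_le_at_residualPair hK hp hH' κ hκ hγ vbar θsub θquot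
    hpair Sf hSf' hSfp θ hθ
  have hcork := le_antisymm hle hge
  -- finiteness of the `p`-torsion of the quotient, and GV Cor. (2.3)
  have hQ := UnrSelmerQuotientTorsionFiniteChar.finite_torsionBy_unrSelmer_quotient hK hp hH' κ hκ hγ vbar θ Sf hSf'
  obtain ⟨hfg, htors, hμ⟩ := hRH D
  haveI := hfg
  obtain ⟨hfgS, htorsS, hμS, hlamS⟩ :=
    UnrSelmerImprimitiveFiniteness.moduleFinite_isTorsion_mu_lambda_of_primitive κ vbar
      (exists_pow_smul_cofree_eq_zero (∅ : Set (PadicAlgCl p)) θ)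
      (isOpen_stabilizer_cofree (∅ : Set (PadicAlgCl p)) θ) hγ
      (Set.empty_subset (↑Sf : Set (HeightOneSpectrum (𝓞 K)))) D htors DS hQ
  exact ⟨hfgS, htorsS, hμS.trans hμ, by rw [hlamS, hcork]⟩

end Package

end Summit.BirchSwinnertonDyer.BirchSwinnertonDyer.Theorems.SplitMultCharImprimitiveShift

end
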